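import Literature.Computability.AlgebraicComplexity.PlethysmStability
import Literature.NumberTheory.DiophantineGeometry.SymmetricGroupRepsFinrankSpechtProofs
import HarnessLib

/-!
# Positivity of plethysm coefficients from row-rigid content tableaux (BIP §7, the method of
Claim 7.1 / Props. 7.2–7.3, abstract form)

Topic `Literature/Computability/AlgebraicComplexity`, continuing `PlethysmStability.lean` §8
(`tabVector` = BIP's `v_T`, the contraction rule Thm. 4.7 and the positivity criterion
`tabVector_apply_ne_zero`).

Source: P. Bürgisser, C. Ikenmeyer, G. Panova, *No occurrence obstructions in geometric complexity
theory*, J. AMS 32 (2019) = arXiv:1604.06431v3, §7: to show `a_λ(d[n]) > 0` one designs a tableau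
`T` of shape `λ` with content `d × n` and a monomial tensor `Φ` (the "row tensor": a box
contributes the variable of its row) such that every bijection `ϑ` respecting `T` with
`val_ϑ(s) ≠ 0` has `val_ϑ(s) = 1` (Claim 7.1 and the proofs of Props. 7.2, 7.3). This file
isolates the combinatorial heart of that method:

* `fst_perm_eq_fst` — **row rigidity**: under four structural hypotheses on the content tableau
  (all classes of size `n`; first-row labels have at most one non-singleton cell; "low" labels
  have ≥ 2 non-singleton cells, none in row `0`, pairwise distinct numbers of singleton cells,
  and non-singleton cells in ≤ 2 rows with a column condition), every class-preserving, weakly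
  column-regular permutation of the cells preserves rows — the abstract form of Claim 7.1 (its
  printed hypotheses `|C_u^1| ≤ n-2` for low `u`, `> n-2` otherwise, are (S1)/(S0), and its
  conclusion `τ_ϑ(u) = u` is the intermediate step `κ = id` of the proof) plus the
  row-preservation step "all nonzero summands have the value `1`", which needs (S4). (The
  tableau printed in the proof of Prop. 7.3 contains a label of multiplicity one, for which a
  respecting bijection of value `-1` exists; a discharge of Prop. 7.3 / Thm. 6.2 along these
  lines therefore uses a corrected tableau — recorded here for the follow-up, not needed in this
  file. Claim 7.1 itself and the tableau of Prop. 7.2 are fine as printed.)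
* `hstar_of_rowRigid` — the bridge from row rigidity of the content tableau of `(T₀, π)`
  (`contentLab`) to the hypothesis of `tabVector_apply_ne_zero`.
* `exists_wreathInvariant_hwv` — **the pipeline**: a row-rigid labelling of `μ ⊢ D m` by `D`
  letters with classes of size `m` yields a nonzero `S_D ≀ S_m`-invariant highest-weight vector of
  weight `μ` in the word model of `(k^N)^{⊗Dm}` (`a_μ(D[m]) > 0`), using the existence of standard
  tableaux (the tree's row-reading tableau `StdFilling.rowReading`) and of a position
  permutation realising the labelling (`exists_comp_perm_eq_of_wordExp_eq`).

With `formOfWord_mem_highestWeightSpace` this is the input format of the named fact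
`bip2019_prop_7_3` (`OccurrenceObstructionsHooks.lean`); what remains for its discharge (or for a
direct proof of Thm. 6.2) is an explicit row-rigid labelling of the hook-like shapes.

## References

* P. Bürgisser, C. Ikenmeyer, G. Panova, *No occurrence obstructions in geometric complexity
  theory*, J. AMS 32 (2019) = arXiv:1604.06431v3: §4(a) Def. 4.1, 4.2, (4.1); §4(b) Def. 4.6,
  (4.2), Thm. 4.7; §7 (7.1), Claim 7.1, Props. 7.2, 7.3. [key `BurgisserIkenmeyerPanovaJAMS2019`]

## Mathlib and tree

Mathlib: `YoungDiagram` (`rowLen`, `mem_iff_lt_rowLen`, `up_left_mem`), `Finset` cardinalities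
(`card_le_card_of_injOn`, `card_image_of_injOn`, `eq_of_subset_of_card_le`, `sum_image`,
`sum_eq_sum_iff_of_le`), `Equiv.Perm`, `Equiv.ofBijective`. Tree: `StdFilling` (`bijective`,
`colStab`, `rowWord`), `tabVector`/`tabVector_apply_ne_zero`/`tabVector_mem_highestWeightSpace`/
`wordPerm_tabVector`, `blockIdx`/`blockPerms` (`PlethysmStability`), `wordExp`,
`exists_comp_perm_eq_of_wordExp_eq` (`Hyperdeterminant`), `StdFilling.rowReading` (a standard
tableau of every shape, `SymmetricGroupRepsFinrankSpechtProofs`).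
-/

open scoped BigOperators

namespace Literature.Computability.AlgebraicComplexity

namespace ContentTableau

variable {α : Type*} [DecidableEq α] (Y : YoungDiagram) (lab : ℕ × ℕ → α)

/-- The class `C_u` of a label `u`: the cells of `Y` carrying it (BIP §4(a): a tableau with
content is "a partition of the set of boxes … into classes `C_1, …, C_d`"). [cite: BurgisserIkenmeyerPanovaJAMS2019, Def. 4.1] -/
def cellsOf (u : α) : Finset (ℕ × ℕ) := Y.cells.filter fun c => lab c = u

/-- The cells of class `u` in the non-singleton columns (columns `< λ₂`).
[cite: BurgisserIkenmeyerPanovaJAMS2019, §7 (`C_u ∖ C_u^1`)] -/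
def nonsingletonCellsOf (u : α) : Finset (ℕ × ℕ) := Y.cells.filter fun c => lab c = u ∧ c.2 < Y.rowLen 1

/-- BIP's `C_u^1`: the cells of class `u` in the singleton columns (columns `≥ λ₂`, necessarily
in row `0`): "We denote by `C_u^1` the subset of `C_u` consisting of the boxes in singleton
columns." [cite: BurgisserIkenmeyerPanovaJAMS2019, §7] -/
def singletonCellsOf (u : α) : Finset (ℕ × ℕ) := Y.cells.filter fun c => lab c = u ∧ Y.rowLen 1 ≤ c.2

/-- The cells of class `u` in the first row. [folklore] -/
def rowZeroCellsOf (u : α) : Finset (ℕ × ℕ) := Y.cells.filter fun c => lab c = u ∧ c.1 = 0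

/-- A label is *low* if its class has a cell below the first row (BIP's labels `u ≤ D`, those of
the subtableau below row `1`). [cite: BurgisserIkenmeyerPanovaJAMS2019, Claim 7.1] -/
def HasLowCell (u : α) : Prop := ∃ c ∈ Y.cells, lab c = u ∧ c.1 ≠ 0

variable {Y lab}

/-- A cell in a singleton column (column `≥ λ₂`) lies in row `0`. [folklore] -/
theorem fst_eq_zero_of_rowLen_one_le {c : ℕ × ℕ} (hc : c ∈ Y) (h : Y.rowLen 1 ≤ c.2) : c.1 = 0 := by
  by_contra h0
  have h1 : 1 ≤ c.1 := Nat.one_le_iff_ne_zero.mpr h0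
  have : ((1 : ℕ), c.2) ∈ Y := Y.up_left_mem h1 (le_refl c.2) (by rw [Prod.mk.eta]; exact hc)
  rw [YoungDiagram.mem_iff_lt_rowLen] at this
  omega

/-- `|C_u| = |C_u ∖ C_u^1| + |C_u^1|`. [folklore] -/
theorem card_nonsingletonCellsOf_add_card_singletonCellsOf (u : α) : (nonsingletonCellsOf Y lab u).card + (singletonCellsOf Y lab u).card = (cellsOf Y lab u).card := by
  classical
  rw [nonsingletonCellsOf, singletonCellsOf, cellsOf]
  have h1 : (Y.cells.filter fun c => lab c = u ∧ c.2 < Y.rowLen 1) =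
      (Y.cells.filter fun c => lab c = u).filter fun c => c.2 < Y.rowLen 1 := by
    rw [Finset.filter_filter]
  have h2 : (Y.cells.filter fun c => lab c = u ∧ Y.rowLen 1 ≤ c.2) =
      (Y.cells.filter fun c => lab c = u).filter fun c => ¬ c.2 < Y.rowLen 1 := by
    rw [Finset.filter_filter]
    congr 1
    ext c
    simp only [not_lt]
  rw [h1, h2, Finset.card_filter_add_card_filter_not]

/-- Singleton-column cells are first-row cells. [folklore] -/
theorem singletonCellsOf_subset_rowZeroCellsOf (u : α) : singletonCellsOf Y lab u ⊆ rowZeroCellsOf Y lab u := by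
  intro c hc
  simp only [singletonCellsOf, rowZeroCellsOf, Finset.mem_filter, YoungDiagram.mem_cells] at hc ⊢
  exact ⟨hc.1, hc.2.1, fst_eq_zero_of_rowLen_one_le hc.1 hc.2.2⟩

/-- If no non-singleton cell of `u` is in row `0`, the first-row cells of `u` are exactly its
singleton cells. [folklore] -/
theorem rowZeroCellsOf_eq_singletonCellsOf_of_forall {u : α} (h : ∀ c ∈ nonsingletonCellsOf Y lab u, c.1 ≠ 0) : rowZeroCellsOf Y lab u = singletonCellsOf Y lab u := by
  refine Finset.Subset.antisymm ?_ (singletonCellsOf_subset_rowZeroCellsOf u)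
  intro c hc
  simp only [singletonCellsOf, rowZeroCellsOf, Finset.mem_filter] at hc ⊢
  refine ⟨hc.1, hc.2.1, ?_⟩
  by_contra hlt
  exact h c (by simp only [nonsingletonCellsOf, Finset.mem_filter]; exact ⟨hc.1, hc.2.1, not_le.mp hlt⟩) hc.2.2

end ContentTableau

open ContentTableau

section RowRigid

variable {α : Type*} [DecidableEq α] {Y : YoungDiagram} {lab : ℕ × ℕ → α} {n : ℕ}

/-- **Row rigidity of a content tableau (BIP Claim 7.1 in abstract form, plus the
row-preservation step, which needs (S4)).** Let the cells of a Young diagram `Y` be labelled (`lab`), all classes having the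
same size `n`, such that: (S0) a label with no cell below row `0` has at most one cell in a
non-singleton column; (S1) a low label has all its non-singleton cells below row `0`, and at least
two of them; (S3) low labels are determined by the number of their singleton cells; (S4) the
non-singleton cells of a low label lie in at most two rows `a ≤ b`, and if `a < b` no row-`a` cell
`y` of it has `(b, col y) ∈ Y`. Then every permutation `τ` of the cells which maps classes to
classes and is *column-regular* in the weak sense `(row (τ c), col c) ∈ Y` for all `c` preserves
the row of every cell. Proof (BIP's counting): singleton cells go to row `0`
(column-regularity), so `|C_u^1| ≤ #(row-0 cells of κu)` for the induced label map `κ`; by (S0),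
(S1) non-low labels go to non-low labels, hence (finiteness) low to low; then
`|C_u^1| ≤ |C_{κu}^1|` for low `u`, summing over the finite set of low labels forces equality and
(S3) gives `κ = id` there; so `τ` permutes `C_u`, `C_u^1` and the non-singleton cells of each low
`u`, and (S4) with column-regularity pins their rows; non-low classes live in row `0`. BIP Claim
7.1 is the special case "`|C_1^1|, …, |C_D^1| ≤ n-2` pairwise distinct and `|C_u^1| > n-2` for
`u > D`" ("Then … `τ_ϑ(u) = u` for all `1 ≤ u ≤ D`" — the step `κ = id` below); (S1)'s "at least
two non-singleton cells" is the printed `|C_u^1| ≤ n-2` and (S0) the printed `> n-2` (the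
tableau printed in the proof of Prop. 7.3 has a label of multiplicity one violating (S1), whence
the corrected tableau of the follow-up; Claim 7.1 is used as printed).
[cite: BurgisserIkenmeyerPanovaJAMS2019, Claim 7.1] -/
theorem fst_perm_eq_fst
    (hcount : ∀ c ∈ Y.cells, (cellsOf Y lab (lab c)).card = n)
    (hS0 : ∀ u, ¬ HasLowCell Y lab u → (nonsingletonCellsOf Y lab u).card ≤ 1)
    (hS1 : ∀ u, HasLowCell Y lab u → (∀ c ∈ nonsingletonCellsOf Y lab u, c.1 ≠ 0) ∧ 2 ≤ (nonsingletonCellsOf Y lab u).card)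
    (hS3 : ∀ u v, HasLowCell Y lab u → HasLowCell Y lab v → (singletonCellsOf Y lab u).card = (singletonCellsOf Y lab v).card → u = v)
    (hS4 : ∀ u, HasLowCell Y lab u → ∃ a b, a ≤ b ∧ (∀ c ∈ nonsingletonCellsOf Y lab u, c.1 = a ∨ c.1 = b) ∧
      (a < b → ∀ c ∈ nonsingletonCellsOf Y lab u, c.1 = a → (b, c.2) ∉ Y))
    (τ : Equiv.Perm Y.cells)
    (hcls : ∀ c c' : Y.cells, lab (τ c) = lab (τ c') ↔ lab c = lab c')
    (hCR : ∀ c : Y.cells, (((τ c : Y.cells) : ℕ × ℕ).1, (c : ℕ × ℕ).2) ∈ Y) :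
    ∀ c : Y.cells, ((τ c : Y.cells) : ℕ × ℕ).1 = (c : ℕ × ℕ).1 := by
  classical
  -- plain-function version of `τ`
  set T : ℕ × ℕ → ℕ × ℕ := fun c => if h : c ∈ Y.cells then ((τ ⟨c, h⟩ : Y.cells) : ℕ × ℕ) else c
    with hT
  have hTmem : ∀ c ∈ Y.cells, T c ∈ Y.cells := fun c hc => by
    simp only [hT, dif_pos hc]; exact (τ ⟨c, hc⟩).2
  have hTapp : ∀ (c : Y.cells), T c = ((τ c : Y.cells) : ℕ × ℕ) := fun c => by
    simp only [hT, dif_pos c.2]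
  have hTinj : Set.InjOn T Y.cells := by
    intro c hc c' hc' h
    simp only [hT, Finset.mem_coe.mp hc, Finset.mem_coe.mp hc', dif_pos] at h
    have := τ.injective (Subtype.ext h)
    exact congrArg Subtype.val this
  have hTinjOn : ∀ s : Finset (ℕ × ℕ), s ⊆ Y.cells → Set.InjOn T s := fun s hs =>
    hTinj.mono (Finset.coe_subset.mpr hs)
  have hscls_sub : ∀ u, singletonCellsOf Y lab u ⊆ Y.cells := fun u => Finset.filter_subset _ _
  have hncls_sub : ∀ u, nonsingletonCellsOf Y lab u ⊆ Y.cells := fun u => Finset.filter_subset _ _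
  -- Step 1: singleton-column cells go to row 0
  have hrow0 : ∀ c ∈ Y.cells, Y.rowLen 1 ≤ c.2 → (T c).1 = 0 := by
    intro c hc h2
    have h := hCR ⟨c, hc⟩
    rw [← hTapp] at h
    exact fst_eq_zero_of_rowLen_one_le (c := ((T c).1, c.2)) h h2
  -- Step 2: the induced map on labels
  set κ : α → α := fun u => if h : ∃ c ∈ Y.cells, lab c = u then lab (T h.choose) else u with hκ
  have hκlab : ∀ c ∈ Y.cells, lab (T c) = κ (lab c) := by
    intro c hc
    have hex : ∃ c' ∈ Y.cells, lab c' = lab c := ⟨c, hc, rfl⟩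
    simp only [hκ, dif_pos hex]
    have h1 := hex.choose_spec
    rw [hTapp ⟨c, hc⟩, hTapp ⟨hex.choose, h1.1⟩]
    exact (hcls ⟨c, hc⟩ ⟨hex.choose, h1.1⟩).mpr h1.2.symm
  set L : Finset α := Y.cells.image lab with hL
  have hκinj : Set.InjOn κ L := by
    intro u hu v hv huv
    obtain ⟨c, hc, rfl⟩ := Finset.mem_image.mp (Finset.mem_coe.mp hu)
    obtain ⟨c', hc', rfl⟩ := Finset.mem_image.mp (Finset.mem_coe.mp hv)
    rw [← hκlab c hc, ← hκlab c' hc', hTapp ⟨c, hc⟩, hTapp ⟨c', hc'⟩] at huv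
    exact (hcls ⟨c, hc⟩ ⟨c', hc'⟩).mp huv
  have hκmem : ∀ u ∈ L, κ u ∈ L := by
    intro u hu
    obtain ⟨c, hc, rfl⟩ := Finset.mem_image.mp hu
    rw [← hκlab c hc]
    exact Finset.mem_image_of_mem _ (hTmem c hc)
  -- images of cells of a class
  have hTcls : ∀ u, ∀ c ∈ cellsOf Y lab u, T c ∈ cellsOf Y lab (κ u) := by
    intro u c hc
    simp only [cellsOf, Finset.mem_filter] at hc ⊢
    exact ⟨hTmem c hc.1, by rw [hκlab c hc.1, hc.2]⟩
  have hTscls : ∀ u, ∀ c ∈ singletonCellsOf Y lab u, T c ∈ rowZeroCellsOf Y lab (κ u) := by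
    intro u c hc
    simp only [singletonCellsOf, Finset.mem_filter] at hc
    simp only [rowZeroCellsOf, Finset.mem_filter]
    exact ⟨hTmem c hc.1, by rw [hκlab c hc.1, hc.2.1], hrow0 c hc.1 hc.2.2⟩
  have hcard_s : ∀ u, (singletonCellsOf Y lab u).card ≤ (rowZeroCellsOf Y lab (κ u)).card := fun u =>
    Finset.card_le_card_of_injOn T (hTscls u) fun c hc c' hc' h =>
      hTinj (Finset.mem_coe.mpr (Finset.mem_filter.mp hc).1)
        (Finset.mem_coe.mpr (Finset.mem_filter.mp hc').1) h
  -- counts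
  have hn : ∀ u ∈ L, (nonsingletonCellsOf Y lab u).card + (singletonCellsOf Y lab u).card = n := by
    intro u hu
    obtain ⟨c, hc, rfl⟩ := Finset.mem_image.mp hu
    rw [card_nonsingletonCellsOf_add_card_singletonCellsOf, hcount c hc]
  have hncls_le : ∀ u ∈ L, (nonsingletonCellsOf Y lab u).card ≤ n := fun u hu => by have := hn u hu; omega
  have hzbig : ∀ u ∈ L, ¬ HasLowCell Y lab u → (rowZeroCellsOf Y lab u).card = n := by
    intro u hu hs
    obtain ⟨c, hc, rfl⟩ := Finset.mem_image.mp hu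
    rw [← hcount c hc]
    congr 1
    simp only [rowZeroCellsOf, cellsOf]
    refine Finset.filter_congr fun c' hc' => ⟨fun h => h.1, fun h => ⟨h, ?_⟩⟩
    by_contra hne
    exact hs ⟨c', hc', h, hne⟩
  -- Step 5: big labels go to big labels
  have hbig : ∀ u ∈ L, ¬ HasLowCell Y lab u → ¬ HasLowCell Y lab (κ u) := by
    intro u hu hs hs'
    have h1 := hcard_s u
    have h2 := hS0 u hs
    have h3 := hn u hu
    obtain ⟨hne, h2'⟩ := hS1 (κ u) hs'
    rw [rowZeroCellsOf_eq_singletonCellsOf_of_forall hne] at h1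
    have h4 := hn (κ u) (hκmem u hu)
    have h5 := hncls_le (κ u) (hκmem u hu)
    omega
  set Lb := L.filter fun u => ¬ HasLowCell Y lab u with hLb
  set Ls := L.filter fun u => HasLowCell Y lab u with hLs
  have hLb_image : Lb.image κ = Lb := by
    apply Finset.eq_of_subset_of_card_le
    · intro v hv
      obtain ⟨u, hu, rfl⟩ := Finset.mem_image.mp hv
      rw [hLb, Finset.mem_filter] at hu ⊢
      exact ⟨hκmem u hu.1, hbig u hu.1 hu.2⟩
    · rw [Finset.card_image_of_injOn fun u hu v hv h =>
        hκinj (Finset.mem_coe.mpr (Finset.mem_filter.mp hu).1)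
          (Finset.mem_coe.mpr (Finset.mem_filter.mp hv).1) h]
  have hsmall : ∀ u ∈ Ls, κ u ∈ Ls := by
    intro u hu
    rw [hLs, Finset.mem_filter] at hu
    rw [hLs, Finset.mem_filter]
    refine ⟨hκmem u hu.1, ?_⟩
    by_contra hns
    have hmem : κ u ∈ Lb := by rw [hLb, Finset.mem_filter]; exact ⟨hκmem u hu.1, hns⟩
    rw [← hLb_image] at hmem
    obtain ⟨v, hv, hvu⟩ := Finset.mem_image.mp hmem
    rw [hLb, Finset.mem_filter] at hv
    have : v = u := hκinj (Finset.mem_coe.mpr hv.1) (Finset.mem_coe.mpr hu.1) hvu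
    exact hv.2 (this ▸ hu.2)
  have hLs_image : Ls.image κ = Ls := by
    apply Finset.eq_of_subset_of_card_le
    · intro v hv
      obtain ⟨u, hu, rfl⟩ := Finset.mem_image.mp hv
      exact hsmall u hu
    · rw [Finset.card_image_of_injOn fun u hu v hv h =>
        hκinj (Finset.mem_coe.mpr (Finset.mem_filter.mp hu).1)
          (Finset.mem_coe.mpr (Finset.mem_filter.mp hv).1) h]
  -- Step 6: on small labels `κ = id`
  have hle : ∀ u ∈ Ls, (singletonCellsOf Y lab u).card ≤ (singletonCellsOf Y lab (κ u)).card := by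
    intro u hu
    have h := hcard_s u
    have hs' : HasLowCell Y lab (κ u) := (Finset.mem_filter.mp (hsmall u hu)).2
    rwa [rowZeroCellsOf_eq_singletonCellsOf_of_forall (hS1 _ hs').1] at h
  have hsum : ∑ u ∈ Ls, (singletonCellsOf Y lab (κ u)).card = ∑ u ∈ Ls, (singletonCellsOf Y lab u).card := by
    rw [← Finset.sum_image (f := fun u => (singletonCellsOf Y lab u).card) fun u hu v hv h =>
      hκinj (Finset.mem_coe.mpr (Finset.mem_filter.mp hu).1)
        (Finset.mem_coe.mpr (Finset.mem_filter.mp hv).1) h, hLs_image]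
  have heq : ∀ u ∈ Ls, (singletonCellsOf Y lab u).card = (singletonCellsOf Y lab (κ u)).card :=
    (Finset.sum_eq_sum_iff_of_le hle).mp hsum.symm
  have hκid : ∀ u ∈ Ls, κ u = u := by
    intro u hu
    have hs : HasLowCell Y lab u := (Finset.mem_filter.mp hu).2
    have hs' : HasLowCell Y lab (κ u) := (Finset.mem_filter.mp (hsmall u hu)).2
    exact (hS3 _ _ hs hs' (heq u hu)).symm
  -- Step 7: small labels keep rows
  have hT_scls : ∀ u ∈ Ls, ∀ c ∈ singletonCellsOf Y lab u, T c ∈ singletonCellsOf Y lab u := by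
    intro u hu c hc
    have hs : HasLowCell Y lab u := (Finset.mem_filter.mp hu).2
    have h := hTscls u c hc
    rwa [hκid u hu, rowZeroCellsOf_eq_singletonCellsOf_of_forall (hS1 u hs).1] at h
  have hT_ncls : ∀ u ∈ Ls, ∀ c ∈ nonsingletonCellsOf Y lab u, T c ∈ nonsingletonCellsOf Y lab u := by
    intro u hu c hc
    have hc' : c ∈ cellsOf Y lab u := by
      simp only [nonsingletonCellsOf, cellsOf, Finset.mem_filter] at hc ⊢; exact ⟨hc.1, hc.2.1⟩
    have h1 := hTcls u c hc'
    rw [hκid u hu] at h1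
    -- `T c` is not a singleton cell: those are the images of the singleton cells
    have himage : (singletonCellsOf Y lab u).image T = singletonCellsOf Y lab u := by
      apply Finset.eq_of_subset_of_card_le
      · intro x hx
        obtain ⟨c₁, hc₁, rfl⟩ := Finset.mem_image.mp hx
        exact hT_scls u hu c₁ hc₁
      · exact (Finset.card_image_of_injOn (hTinjOn _ (hscls_sub u))).symm.le
    simp only [cellsOf, Finset.mem_filter] at h1
    simp only [nonsingletonCellsOf, Finset.mem_filter]
    refine ⟨h1.1, h1.2, ?_⟩
    by_contra hge
    have hTs : T c ∈ singletonCellsOf Y lab u := by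
      simp only [singletonCellsOf, Finset.mem_filter]; exact ⟨h1.1, h1.2, not_lt.mp hge⟩
    rw [← himage] at hTs
    obtain ⟨c₁, hc₁, hc₁c⟩ := Finset.mem_image.mp hTs
    have : c₁ = c := hTinj (Finset.mem_coe.mpr (Finset.mem_filter.mp hc₁).1)
      (Finset.mem_coe.mpr (Finset.mem_filter.mp hc).1) hc₁c
    subst this
    simp only [singletonCellsOf, nonsingletonCellsOf, Finset.mem_filter] at hc₁ hc
    omega
  -- conclusion
  intro c
  obtain ⟨c, hc⟩ := c
  rw [← hTapp ⟨c, hc⟩]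
  change (T c).1 = c.1
  have hcL : lab c ∈ L := Finset.mem_image_of_mem _ hc
  by_cases hs : HasLowCell Y lab (lab c)
  · have huLs : lab c ∈ Ls := Finset.mem_filter.mpr ⟨hcL, hs⟩
    by_cases hcol : c.2 < Y.rowLen 1
    · -- a non-singleton cell of a small label
      have hcn : c ∈ nonsingletonCellsOf Y lab (lab c) := Finset.mem_filter.mpr ⟨hc, rfl, hcol⟩
      obtain ⟨a, b, hab, hrows, hexc⟩ := hS4 _ hs
      -- the row-`a` cells are mapped into row `a`
      have hA : ∀ x ∈ nonsingletonCellsOf Y lab (lab c), x.1 = a → (T x).1 = a := by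
        intro x hx hxa
        have hTx := hT_ncls _ huLs x hx
        rcases hrows _ hTx with h | h
        · exact h
        · rcases hab.lt_or_eq with hlt | heq
          · exfalso
            have hY := hCR ⟨x, (Finset.mem_filter.mp hx).1⟩
            rw [← hTapp, h] at hY
            exact hexc hlt x hx hxa hY
          · rw [h, heq]
      rcases hrows c hcn with hca | hcb
      · rw [hA c hcn hca, hca]
      · -- the row-`b` cells: by counting they cannot go to row `a`
        rcases hab.lt_or_eq with hlt | heq
        · have hTc := hT_ncls _ huLs c hcn
          rcases hrows _ hTc with h | h
          · exfalso
            set A := (nonsingletonCellsOf Y lab (lab c)).filter fun x => x.1 = a with hAdef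
            have hAimage : A.image T = A := by
              apply Finset.eq_of_subset_of_card_le
              · intro y hy
                obtain ⟨x, hx, rfl⟩ := Finset.mem_image.mp hy
                rw [hAdef, Finset.mem_filter] at hx ⊢
                exact ⟨hT_ncls _ huLs x hx.1, hA x hx.1 hx.2⟩
              · exact (Finset.card_image_of_injOn (hTinjOn _
                  ((Finset.filter_subset _ _).trans (hncls_sub _)))).symm.le
            have hTcA : T c ∈ A := by rw [hAdef, Finset.mem_filter]; exact ⟨hTc, h⟩
            rw [← hAimage] at hTcA
            obtain ⟨x, hx, hxc⟩ := Finset.mem_image.mp hTcA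
            have hxc' : x = c := hTinj
              (Finset.mem_coe.mpr (Finset.mem_filter.mp (Finset.mem_filter.mp hx).1).1)
              (Finset.mem_coe.mpr hc) hxc
            rw [hAdef, Finset.mem_filter] at hx
            rw [hxc'] at hx
            omega
          · rw [h, hcb]
        · subst heq
          rw [hA c hcn hcb, hcb]
    · -- a singleton cell
      have h2 : Y.rowLen 1 ≤ c.2 := not_lt.mp hcol
      rw [hrow0 c hc h2, fst_eq_zero_of_rowLen_one_le hc h2]
  · -- a cell of a big label: everything in row 0
    have hc0 : c.1 = 0 := by
      by_contra hne; exact hs ⟨c, hc, rfl, hne⟩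
    have hs' := hbig _ hcL hs
    have hT0 : (T c).1 = 0 := by
      by_contra hne
      exact hs' ⟨T c, hTmem c hc, hκlab c hc, hne⟩
    rw [hT0, hc0]

end RowRigid


section Bridge

open ContentTableau

variable {k : Type*} [Field k] [CharZero k] {N D m : ℕ} {Y : YoungDiagram}

/-- The content labelling of the cells attached to a standard tableau `T₀` and a position
permutation `π` (the datum of `tabVector`): the cell `T₀ p` carries the block of `π p` (junk
`none` off the diagram) — BIP's `T = T_λ(π)` ("replace in `π T_λ^std` the numbers in the block
`B_u` by the same letter"). [cite: BurgisserIkenmeyerPanovaJAMS2019, §4(a) (the tableau `T_λ(π)`)] -/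
noncomputable def contentLab (hd : Y.cells.card = D * m) (T₀ : Literature.NumberTheory.DiophantineGeometry.StdFilling (D * m) Y)
    (π : Equiv.Perm (Fin (D * m))) : ℕ × ℕ → Option (Fin D) :=
  fun c => if h : c ∈ Y.cells then
    some (blockIdx D m (π ((Equiv.ofBijective _ (T₀.bijective hd)).symm ⟨c, h⟩))) else none

/-- The content label of the cell of entry `p` is the block of `π p`. [folklore] -/
theorem contentLab_apply (hd : Y.cells.card = D * m) (T₀ : Literature.NumberTheory.DiophantineGeometry.StdFilling (D * m) Y)
    (π : Equiv.Perm (Fin (D * m))) (p : Fin (D * m)) :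
    contentLab hd T₀ π (T₀.1 p) = some (blockIdx D m (π p)) := by
  have hp : T₀.1 p ∈ Y.cells := (YoungDiagram.mem_cells _).2 (T₀.mem p)
  rw [contentLab, dif_pos hp]
  congr 3
  rw [Equiv.symm_apply_eq]
  rfl

/-- **Bridge to the positivity criterion.** If the content tableau of `(T₀, π)` is row-rigid
(every class-preserving, weakly column-regular permutation of the cells preserves rows), then
the hypothesis of `tabVector_apply_ne_zero` holds: for `τ` in the wreath product and `σ ∈ C_{T₀}`
with `T₀(σ⁻¹ p) = (row of the cell of π⁻¹τπ p, col p)` for all `p`, the cell permutation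
`T₀ ∘ π⁻¹τπ ∘ T₀⁻¹` is class-preserving and column-regular, so it preserves rows and `σ = 1`.
(BIP: the respecting bijections are `ϑ = σ ∘ π ∘ ϑ₀`, Thm. 4.7.) [cite: BurgisserIkenmeyerPanovaJAMS2019, Thm. 4.7 and Claim 7.1] -/
theorem hstar_of_rowRigid (hN : ∀ x ∈ Y.cells, x.1 < N) (hd : Y.cells.card = D * m)
    (T₀ : Literature.NumberTheory.DiophantineGeometry.StdFilling (D * m) Y) (π : Equiv.Perm (Fin (D * m)))
    (H : ∀ τ' : Equiv.Perm Y.cells,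
      (∀ c c' : Y.cells, contentLab hd T₀ π (τ' c) = contentLab hd T₀ π (τ' c') ↔
        contentLab hd T₀ π c = contentLab hd T₀ π c') →
      (∀ c : Y.cells, (((τ' c : Y.cells) : ℕ × ℕ).1, (c : ℕ × ℕ).2) ∈ Y) →
      ∀ c : Y.cells, ((τ' c : Y.cells) : ℕ × ℕ).1 = (c : ℕ × ℕ).1) :
    ∀ τ ∈ blockPerms D m, ∀ σ ∈ T₀.colStab,
      (∀ p, T₀.1 (σ⁻¹ p) = (((T₀.rowWord hN ∘ ⇑π⁻¹) (τ (π p)) : ℕ), (T₀.1 p).2)) → σ = 1 := by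
  intro τ hτ σ hσ hσp
  set e : Fin (D * m) ≃ Y.cells := Equiv.ofBijective _ (T₀.bijective hd) with he
  have he_apply : ∀ p, ((e p : Y.cells) : ℕ × ℕ) = T₀.1 p := fun p => rfl
  set ρ : Equiv.Perm (Fin (D * m)) := π⁻¹ * τ * π with hρ
  have hρ_apply : ∀ p, ρ p = π⁻¹ (τ (π p)) := fun p => rfl
  set τ' : Equiv.Perm Y.cells := e.symm.trans (ρ.trans e) with hτ'
  have hτ'_apply : ∀ p, τ' (e p) = e (ρ p) := fun p => by simp [hτ']
  -- class preservation
  have hcls : ∀ c c' : Y.cells, contentLab hd T₀ π (τ' c) = contentLab hd T₀ π (τ' c') ↔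
      contentLab hd T₀ π c = contentLab hd T₀ π c' := by
    intro c c'
    obtain ⟨p, rfl⟩ := e.surjective c
    obtain ⟨p', rfl⟩ := e.surjective c'
    rw [hτ'_apply, hτ'_apply, he_apply, he_apply, he_apply, he_apply, contentLab_apply,
      contentLab_apply, contentLab_apply, contentLab_apply, Option.some_inj, Option.some_inj,
      hρ_apply, hρ_apply]
    rw [show π (π⁻¹ (τ (π p))) = τ (π p) by simp, show π (π⁻¹ (τ (π p'))) = τ (π p') by simp]
    exact mem_blockPerms.mp hτ _ _
  -- column regularity
  have hrow : ∀ p, (((e (ρ p)) : Y.cells) : ℕ × ℕ).1 = ((T₀.rowWord hN ∘ ⇑π⁻¹) (τ (π p)) : ℕ) := by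
    intro p
    rw [he_apply, Function.comp_apply, Literature.NumberTheory.DiophantineGeometry.StdFilling.rowWord_val, hρ_apply]
  have hCR : ∀ c : Y.cells, (((τ' c : Y.cells) : ℕ × ℕ).1, (c : ℕ × ℕ).2) ∈ Y := by
    intro c
    obtain ⟨p, rfl⟩ := e.surjective c
    rw [hτ'_apply, hrow p, he_apply, ← hσp p]
    exact T₀.mem _
  have hfix := H τ' hcls hCR
  ext p : 1
  have h1 := hfix (e p)
  rw [hτ'_apply, hrow p, he_apply] at h1
  -- so `T₀ (σ⁻¹ p) = T₀ p`
  have h2 : T₀.1 (σ⁻¹ p) = T₀.1 p := by rw [hσp p, h1]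
  have h3 : σ⁻¹ p = p := T₀.injective h2
  have := congrArg σ h3
  simpa using this.symm

end Bridge

section Pipeline

open ContentTableau

variable {k : Type*} [Field k] [CharZero k]

variable {N D m : ℕ}

omit [CharZero k] in
/-- Every block has `m` positions. [folklore] -/
theorem card_filter_blockIdx_eq (u : Fin D) :
    (Finset.univ.filter fun p : Fin (D * m) => blockIdx D m p = u).card = m := by
  classical
  have : (Finset.univ.filter fun p : Fin (D * m) => blockIdx D m p = u) =
      Finset.univ.image fun q : Fin m => finProdFinEquiv (u, q) := by
    ext p
    simp only [Finset.mem_filter, Finset.mem_univ, true_and, Finset.mem_image]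
    constructor
    · intro h
      exact ⟨(finProdFinEquiv.symm p).2, by rw [← h]; exact finProdFinEquiv_blockIdx p⟩
    · rintro ⟨q, rfl⟩
      exact blockIdx_finProdFinEquiv u q
  rw [this, Finset.card_image_of_injective _ fun q q' h => by
    have := finProdFinEquiv.injective h; exact (Prod.mk.inj this).2]
  simp

/-- **Positivity of a plethysm coefficient from a row-rigid content tableau** (the method of
BIP §7: "we shall design `T` and `s` in such a way that `val_ϑ(s) ≥ 0` for all `ϑ` and there are
only few `ϑ` with `val_ϑ(s) > 0`"). Let `μ ⊢ D·m` have at most `N` parts and let `L` label its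
cells by `Fin D` with all classes of size `m`, row-rigidly (conclusion of `fst_perm_eq_fst`).
Then there is a NONZERO `S_D ≀ S_m`-invariant highest-weight vector of weight `μ` in the word
model of `(k^N)^{⊗Dm}`, i.e. `a_μ(D[m]) > 0`: take a standard tableau `T₀`
(`StdFilling.rowReading`), a position permutation `π` with "block of `π p`" = `L (T₀ p)`
(`exists_comp_perm_eq_of_wordExp_eq`), and the tableau vector `v_T = tabVector T₀ π`, which does
not vanish at the row tensor (`tabVector_apply_ne_zero` with `hstar_of_rowRigid`). With
`formOfWord_mem_highestWeightSpace` (`PlethysmStability.lean`) this yields a nonzero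
highest-weight vector of weight `μ^*` among the forms of degree `D` on `Sym^m`.
[cite: BurgisserIkenmeyerPanovaJAMS2019, §7 (method) with Thm. 4.7 and Prop. 4.5] -/
theorem exists_wreathInvariant_hwv (μ : Nat.Partition (D * m)) (hμ : μ.parts.card ≤ N)
    (L : ℕ × ℕ → Fin D) (hfib : ∀ u, (μ.youngDiagram.cells.filter fun c => L c = u).card = m)
    (hrigid : ∀ τ' : Equiv.Perm μ.youngDiagram.cells,
      (∀ c c' : μ.youngDiagram.cells, L (τ' c) = L (τ' c') ↔ L c = L c') →
      (∀ c : μ.youngDiagram.cells, (((τ' c : μ.youngDiagram.cells) : ℕ × ℕ).1, (c : ℕ × ℕ).2) ∈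
        μ.youngDiagram) →
      ∀ c : μ.youngDiagram.cells, ((τ' c : μ.youngDiagram.cells) : ℕ × ℕ).1 = (c : ℕ × ℕ).1) :
    ∃ x : Literature.NumberTheory.DiophantineGeometry.Word N (D * m) → k, x ∈ Literature.NumberTheory.DiophantineGeometry.highestWeightSpace (Literature.NumberTheory.DiophantineGeometry.wordRep k N (D * m)) (Literature.NumberTheory.DiophantineGeometry.Weight.ofPartition N μ) ∧
      x ≠ 0 ∧ ∀ τ ∈ blockPerms D m, Literature.NumberTheory.DiophantineGeometry.wordPerm k τ x = x := by
  classical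
  set Y := μ.youngDiagram with hY
  have hN : ∀ x ∈ Y.cells, x.1 < N := fun x hx => Literature.NumberTheory.DiophantineGeometry.fst_lt_of_mem_youngDiagram μ hμ hx
  have hd : Y.cells.card = D * m := μ.card_cells_youngDiagram
  obtain ⟨T₀⟩ : Nonempty (Literature.NumberTheory.DiophantineGeometry.StdFilling (D * m) Y) := ⟨Literature.NumberTheory.DiophantineGeometry.StdFilling.rowReading μ⟩
  set e : Fin (D * m) ≃ Y.cells := Equiv.ofBijective _ (T₀.bijective hd) with he
  have he_apply : ∀ p, ((e p : Y.cells) : ℕ × ℕ) = T₀.1 p := fun p => rfl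
  -- a position permutation realising the labelling
  have hcontent : wordExp (blockIdx D m) = wordExp (fun p => L (e p)) := by
    ext u
    rw [wordExp_apply, wordExp_apply, card_filter_blockIdx_eq]
    refine ((hfib u).symm.trans ?_).trans rfl
    symm
    refine Finset.card_bij (fun p _ => ((e p : Y.cells) : ℕ × ℕ)) ?_ ?_ ?_
    · intro p hp
      simp only [Finset.mem_filter, Finset.mem_univ, true_and] at hp
      exact Finset.mem_filter.mpr ⟨(e p).2, hp⟩
    · intro p _ p' _ h
      exact e.injective (Subtype.ext h)
    · intro c hc
      rw [Finset.mem_filter] at hc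
      refine ⟨e.symm ⟨c, hc.1⟩, ?_, ?_⟩
      · simp only [Finset.mem_filter, Finset.mem_univ, true_and, Equiv.apply_symm_apply]
        exact hc.2
      · simp
  obtain ⟨π, hπ⟩ := exists_comp_perm_eq_of_wordExp_eq hcontent
  have hπp : ∀ p, blockIdx D m (π p) = L (e p) := fun p => congrFun hπ p
  -- the tableau vector
  refine ⟨tabVector k hN T₀ π, ?_, ?_, fun τ hτ => wordPerm_tabVector hN T₀ π hτ⟩
  · rw [← Literature.NumberTheory.DiophantineGeometry.ydWeight_youngDiagram]
    exact tabVector_mem_highestWeightSpace hN T₀ hd π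
  · intro h0
    refine tabVector_apply_ne_zero hN T₀ π (hstar_of_rowRigid hN hd T₀ π fun τ' hcls hCR => ?_)
      (by rw [h0]; rfl)
    -- the content labelling of `(T₀, π)` is `some ∘ L` on cells
    have hlab : ∀ c : Y.cells, contentLab hd T₀ π c = some (L c) := by
      intro c
      obtain ⟨p, rfl⟩ := e.surjective c
      rw [he_apply, contentLab_apply, hπp, he_apply]
    refine hrigid τ' (fun c c' => ?_) hCR
    have := hcls c c'
    rw [hlab, hlab, hlab, hlab, Option.some_inj, Option.some_inj] at this
    exact this

end Pipeline

end Literature.Computability.AlgebraicComplexity
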